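import Literature.Analysis.FluidPDE.NSSereginMildCompactness
import Literature.Analysis.FluidPDE.LocalEnergySolutionsOn
import Literature.Analysis.FluidPDE.KatoCaloricField
import HarnessLib

/-!
# The caloric layer bound at every time from the bound at almost every time

Analysis/FluidPDE proof file (theorems only, no definitions, no named facts) on the way to the
discharge of `Literature.Analysis.FluidPDE.BarkerPrange2020_thm2` (Barker–Prange 2020, Thm. 2) by
compactness. The Grönwall step of the layer estimate (`decay_of_window`, Jia–Šverák 2013, proof
of Lemma 8) bounds the layer functional `Y(s) = ∫ θ_{x₀}|v(s) - e^{sΔ}v₀|²`,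
`θ_{x₀} = (cutoff 1 (· - x₀))²`, only for almost every time `s`. For a local energy solution
the bound passes to **every** time `t ∈ (0, T)` in the form
`‖v(t) - e^{tΔ}v₀‖_{L²(B(x₀,1))} ≤ √(b(t))` whenever `Y ≤ b` a.e. with `b ≥ 0` non-decreasing
(`IsLocalEnergySolutionOn.eLpNorm_layer_le_of_ae`): by duality it suffices to bound the pairings
`∫ ⟪v(t) - e^{tΔ}v₀, g⟫` with test fields `g` supported in the ball, and these are continuous in
`t` (weak continuity (B.1.6) of `v`, joint smoothness of the caloric extension for `t > 0`),
while at almost every earlier time `s < t` they are bounded by `√(Y(s)) ‖g‖₂ ≤ √(b(t)) ‖g‖₂`.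

## References

* T. Barker, C. Prange, Arch. Ration. Mech. Anal. 236 (2020) 1487–1541 = arXiv:1812.09115, Thm. 2,
  §4.2 (p. 16). [BarkerPrange2020]
* G. Seregin, *Lecture notes on regularity theory for the Navier–Stokes equations* (2014),
  Def. B.1 (B.1.6), (B.1.7). [Seregin2014]
-/

noncomputable section

open MeasureTheory TopologicalSpace Set Function Filter Metric
open _root_.Topology
open scoped ENNReal NNReal RealInnerProductSpace

namespace Literature.Analysis.FluidPDE

namespace BarkerPrange2020

section Main

variable {T : ℝ} {v₀ : EuclideanSpace ℝ (Fin 3) → EuclideanSpace ℝ (Fin 3)}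
  {v : ℝ → EuclideanSpace ℝ (Fin 3) → EuclideanSpace ℝ (Fin 3)}
  {π : ℝ → EuclideanSpace ℝ (Fin 3) → ℝ}

/-- A point of positive-measure sets: if a property holds a.e. on `(0, T)` then every interval
`(t₁, t) ⊆ (0, T)` with `t₁ < t` contains a point where it holds together with any property
holding on a left neighbourhood of `t`. [folklore] -/
theorem exists_mem_Ioo_of_ae_of_eventually {T t : ℝ} (htT : t ≤ T) (ht : 0 < t) {p q : ℝ → Prop}
    (hp : ∀ᵐ s ∂(volume.restrict (Ioo (0 : ℝ) T)), p s) (hq : ∀ᶠ s in 𝓝[<] t, q s) :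
    ∃ s, s < t ∧ 0 < s ∧ p s ∧ q s := by
  obtain ⟨l, hlt, hl⟩ := mem_nhdsLT_iff_exists_Ioo_subset.1 hq
  set t₁ : ℝ := max l (t / 2) with ht₁
  have ht₁t : t₁ < t := max_lt hlt (by linarith)
  have ht₁0 : 0 < t₁ := lt_of_lt_of_le (by linarith) (le_max_right _ _)
  set S : Set ℝ := Ioo t₁ t with hS
  have hSsub : S ⊆ Ioo 0 T := Ioo_subset_Ioo ht₁0.le htT
  have hp' : ∀ᵐ s ∂(volume.restrict S), p s := ae_restrict_of_ae_restrict_of_subset hSsub hp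
  have hmem : ∀ᵐ s ∂(volume.restrict S), s ∈ S := ae_restrict_mem measurableSet_Ioo
  haveI : (ae (volume.restrict S)).NeBot := by
    rw [ae_neBot]
    intro h0
    have : volume S = 0 := by rwa [Measure.restrict_eq_zero] at h0
    rw [hS, Real.volume_Ioo] at this
    have h1 : 0 < ENNReal.ofReal (t - t₁) := ENNReal.ofReal_pos.2 (by linarith)
    exact h1.ne' this
  obtain ⟨s, hps, hsS⟩ := (hp'.and hmem).exists
  exact ⟨s, hsS.2, ht₁0.trans hsS.1, hps, hl ⟨(le_max_left _ _).trans_lt hsS.1, hsS.2⟩⟩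

set_option maxHeartbeats 1600000 in
/-- **The layer bound at every time.** Let `(v, π)` be a local energy solution on
`(0,T) × ℝ³` with datum `v₀ ∈ L²(ℝ³)`, `x₀` a centre, `b ≥ 0` non-decreasing, and suppose
`Y(s) = ∫ (cutoff 1 (x - x₀))² |v(s,x) - e^{sΔ}v₀(x)|² dx ≤ b(s)` for a.e. `s ∈ (0, T)`. Then
`‖v(t) - e^{tΔ}v₀‖_{L²(B(x₀,1))} ≤ √(b(t))` for **every** `t ∈ (0, T)`. Proof: by duality
(`eLpNorm_two_le_of_forall_isTestFunctionOn`) it suffices to show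
`|∫⟪v(t) - e^{tΔ}v₀, g⟫| ≤ √(b(t)) ‖g‖₂` for test fields `g` supported in the ball; the pairing
is continuous in the time at `t` (weak continuity of `v`, joint smoothness of the caloric
extension), and at a.e. `s < t` it is `≤ ‖v(s) - e^{sΔ}v₀‖_{L²(B₁)}‖g‖₂ ≤ √(Y(s))‖g‖₂ ≤ √(b(t))‖g‖₂`
(the weight is `1` on `B(x₀,1)`, `b` is non-decreasing). [cite: Seregin2014, Def. B.1 (B.1.6); BarkerPrange2020, §4.2 (arXiv:1812.09115 p. 16)] -/
theorem _root_.Literature.Analysis.FluidPDE.IsLocalEnergySolutionOn.eLpNorm_layer_le_of_ae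
    (h : IsLocalEnergySolutionOn T 1 v₀ v π) (hv₀ : MemLp v₀ 2 volume)
    (x₀ : EuclideanSpace ℝ (Fin 3)) {b : ℝ → ℝ} (hb0 : ∀ t, 0 ≤ b t) (hmono : Monotone b)
    (hae : ∀ᵐ s ∂(volume.restrict (Ioo (0 : ℝ) T)),
      ∫ x, cutoff (1 : ℝ) (x - x₀) ^ 2 * ‖v s x - heatFlow v₀ (1 * s) x‖ ^ 2 ≤ b s)
    {t : ℝ} (ht : t ∈ Ioo 0 T) :
    eLpNorm (v t - heatFlow v₀ (1 * t)) 2 (volume.restrict (ball x₀ 1)) ≤ ENNReal.ofReal (Real.sqrt (b t)) := by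
  haveI : ENNReal.HolderConjugate (2 : ℝ≥0∞) 2 := ENNReal.HolderConjugate.instTwoTwo
  set S : Opens (EuclideanSpace ℝ (Fin 3)) := ⟨ball x₀ 1, isOpen_ball⟩ with hS
  set μB : Measure (EuclideanSpace ℝ (Fin 3)) := volume.restrict (ball x₀ 1) with hμB
  have hSμ : volume.restrict (S : Set (EuclideanSpace ℝ (Fin 3))) = μB := rfl
  set e : ℝ → EuclideanSpace ℝ (Fin 3) → EuclideanSpace ℝ (Fin 3) := fun s => heatFlow v₀ (1 * s) with he
  -- `L²(B₁)` membership of the slices and of the caloric extension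
  have hvB : ∀ s ∈ Icc 0 T, MemLp (v s) 2 μB := fun s hs => h.memLp_two_ball hs x₀
  have heB : ∀ s, 0 ≤ s → MemLp (e s) 2 μB := fun s hs =>
    (memLp_heatFlow_holds hv₀ (by norm_num) (by positivity : (0 : ℝ) ≤ 1 * s) : MemLp (e s) 2 volume).restrict _
  have hwB : ∀ s ∈ Icc 0 T, MemLp (v s - e s) 2 μB := fun s hs => (hvB s hs).sub (heB s hs.1)
  have htI : t ∈ Icc 0 T := ⟨ht.1.le, ht.2.le⟩
  rw [hSμ.symm] at hwB
  refine eLpNorm_two_le_of_forall_isTestFunctionOn S (hwB t htI) (Real.sqrt_nonneg _) fun g hg => ?_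
  rw [hSμ] at hwB ⊢
  have hgtop : FunctionSpaces.IsTestFunctionOn (⊤ : Opens (EuclideanSpace ℝ (Fin 3))) g := hg.mono le_top
  have hg2 : MemLp g 2 μB :=
    (hg.contDiff.continuous.memLp_of_hasCompactSupport hg.hasCompactSupport).restrict _
  have hsupp : tsupport g ⊆ ball x₀ 1 := hg.tsupport_subset
  -- the pairing `F(s) = ∫⟪v(s) - e(s), g⟫` splits on `[0, T]`
  have hpair : ∀ s ∈ Icc 0 T, ∫ x, ⟪(v s - e s) x, g x⟫ = (∫ x, ⟪v s x, g x⟫) - ∫ x, ⟪e s x, g x⟫ := by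
    intro s hs
    rw [integral_inner_eq_setIntegral_of_tsupport_subset _ hsupp,
      integral_inner_eq_setIntegral_of_tsupport_subset _ hsupp,
      integral_inner_eq_setIntegral_of_tsupport_subset _ hsupp,
      ← integral_sub (integrable_inner_of_memLp_conj (hvB s hs) hg2) (integrable_inner_of_memLp_conj (heB s hs.1) hg2)]
    refine integral_congr_ae (Eventually.of_forall fun x => ?_)
    simp only [Pi.sub_apply, inner_sub_left]
  -- continuity of the caloric pairing at `t` (time cut-off caloric field, globally smooth)
  set K : Set (EuclideanSpace ℝ (Fin 3)) := closedBall x₀ 1 with hK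
  have hKc : IsCompact K := isCompact_closedBall x₀ 1
  have hsuppK : tsupport g ⊆ K := hsupp.trans ball_subset_closedBall
  set Ec : ℝ → EuclideanSpace ℝ (Fin 3) → EuclideanSpace ℝ (Fin 3) :=
    fun s x => Real.smoothTransition (4 * s / t - 1) • heatFlow v₀ (1 * s) x with hEc
  have hEcs : Continuous (uncurry Ec) := (contDiff_uncurry_cutoffHeatFlow hv₀ (by norm_num) one_pos ht.1).continuous
  have hGc : Continuous fun s => ∫ x in K, ⟪Ec s x, g x⟫ := by
    refine continuous_parametric_integral_of_continuous (f := fun s x => ⟪Ec s x, g x⟫) ?_ hKc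
    exact hEcs.inner (hg.contDiff.continuous.comp continuous_snd)
  have hGeq : ∀ s, t / 2 ≤ s → ∫ x, ⟪e s x, g x⟫ = ∫ x in K, ⟪Ec s x, g x⟫ := by
    intro s hs
    rw [integral_inner_eq_setIntegral_of_tsupport_subset _ hsuppK]
    refine integral_congr_ae (Eventually.of_forall fun x => ?_)
    simp only [hEc, he]
    rw [cutoffHeatFlow_eq_of_le ht.1 hs]
  -- continuity of `F` within `(t/2, t]` at `t`, from the left
  set F : ℝ → ℝ := fun s => ∫ x, ⟪(v s - e s) x, g x⟫ with hF
  have hFcont : ContinuousWithinAt F (Iio t) t := by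
    have h1 : ContinuousWithinAt (fun s => ∫ x, ⟪v s x, g x⟫) (Icc 0 T) t := h.weakContinuous g hgtop t htI
    have h2 : ContinuousWithinAt (fun s => ∫ x in K, ⟪Ec s x, g x⟫) (Icc 0 T) t := hGc.continuousWithinAt
    have h3 : ContinuousWithinAt (fun s => (∫ x, ⟪v s x, g x⟫) - ∫ x in K, ⟪Ec s x, g x⟫) (Icc 0 T) t := h1.sub h2
    have h4 : ContinuousWithinAt F (Icc 0 T ∩ Ici (t / 2)) t := by
      refine (h3.mono inter_subset_left).congr (fun s hs => ?_) ?_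
      · rw [hF]; dsimp only; rw [hpair s hs.1, hGeq s hs.2]
      · rw [hF]; dsimp only; rw [hpair t htI, hGeq t (by linarith [ht.1])]
    refine (h4.mono_of_mem_nhdsWithin ?_)
    -- `Icc 0 T ∩ Ici (t/2)` is a neighbourhood of `t` within `Iio t`
    have : Ioo (t / 2) t ⊆ Icc 0 T ∩ Ici (t / 2) := fun s hs =>
      ⟨⟨by linarith [hs.1, ht.1], hs.2.le.trans ht.2.le⟩, hs.1.le⟩
    exact mem_of_superset (Ioo_mem_nhdsLT (by linarith [ht.1])) this
  -- the bound at good times `s < t`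
  set Bd : ℝ := Real.sqrt (b t) * (eLpNorm g 2 μB).toReal with hBd
  have hgood : ∀ s, s < t → 0 < s →
      (∫ x, cutoff (1 : ℝ) (x - x₀) ^ 2 * ‖v s x - heatFlow v₀ (1 * s) x‖ ^ 2 ≤ b s) → |F s| ≤ Bd := by
    intro s hst hs0 hYs
    have hsI : s ∈ Icc 0 T := ⟨hs0.le, (hst.le.trans ht.2.le)⟩
    have hws := hwB s hsI
    -- `‖w(s)‖_{L²(B₁)}² ≤ Y(s) ≤ b(s) ≤ b(t)`
    have hθ1 : ∀ x ∈ ball x₀ 1, cutoff (1 : ℝ) (x - x₀) ^ 2 = 1 := fun x hx => by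
      rw [cutoff_eq_one one_pos (by rw [← dist_eq_norm]; exact (mem_ball.1 hx).le), one_pow]
    have hint : Integrable (fun x => cutoff (1 : ℝ) (x - x₀) ^ 2 * ‖v s x - heatFlow v₀ (1 * s) x‖ ^ 2) volume := by
      -- supported in `B̄(x₀, 2)`, where `v s - e s ∈ L²`
      have hw2 : MemLp (v s - e s) 2 (volume.restrict (closedBall x₀ 2)) := by
        obtain ⟨C, hC⟩ := h.exists_forall_lintegral_ball_le 3
        have hvm : AEStronglyMeasurable (v s) volume := h.sliceMeasurable s hsI
        have hfin : ∫⁻ x in closedBall x₀ 2, ‖v s x‖ₑ ^ 2 < ∞ :=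
          lt_of_le_of_lt (lintegral_mono_set (closedBall_subset_ball (by norm_num)))
            ((hC s hsI x₀).trans_lt ENNReal.coe_lt_top)
        have hv2 : MemLp (v s) 2 (volume.restrict (closedBall x₀ 2)) := by
          refine ⟨hvm.restrict, ?_⟩
          rw [eLpNorm_eq_lintegral_rpow_enorm_toReal (by norm_num) (by norm_num)]
          simp only [ENNReal.toReal_ofNat, ENNReal.rpow_ofNat]
          exact ENNReal.rpow_lt_top_of_nonneg (by norm_num) hfin.ne
        exact hv2.sub ((memLp_heatFlow_holds hv₀ (by norm_num) (by positivity : (0 : ℝ) ≤ 1 * s) :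
          MemLp (e s) 2 volume).restrict _)
      have hθc : Continuous fun x : EuclideanSpace ℝ (Fin 3) => cutoff (1 : ℝ) (x - x₀) ^ 2 :=
        ((contDiff_cutoff (E := EuclideanSpace ℝ (Fin 3)) (n := 0) 1).continuous.comp (continuous_id.sub continuous_const)).pow 2
      have hθbd : ∀ x, ‖cutoff (1 : ℝ) (x - x₀) ^ 2‖ ≤ 1 := fun x => by
        rw [Real.norm_eq_abs, abs_of_nonneg (sq_nonneg _)]
        have h0 := cutoff_nonneg (E := EuclideanSpace ℝ (Fin 3)) 1 (x - x₀)
        have h1 := cutoff_le_one (E := EuclideanSpace ℝ (Fin 3)) 1 (x - x₀)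
        nlinarith
      have hθK : ∀ x, x ∉ closedBall x₀ 2 → cutoff (1 : ℝ) (x - x₀) ^ 2 = 0 := fun x hx => by
        have hx' : 2 * (1 : ℝ) ≤ ‖x - x₀‖ := by
          rw [mem_closedBall, dist_eq_norm] at hx; linarith
        rw [cutoff_eq_zero one_pos hx', zero_pow two_ne_zero]
      -- the integrand vanishes off the closed ball and is integrable on it
      have hsq : Integrable (fun x => ‖(v s - e s) x‖ ^ 2) (volume.restrict (closedBall x₀ 2)) := by
        have := hw2.integrable_norm_rpow two_ne_zero ENNReal.ofNat_ne_top
        simpa [ENNReal.toReal_ofNat] using this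
      have hI : IntegrableOn (fun x => cutoff (1 : ℝ) (x - x₀) ^ 2 * ‖v s x - heatFlow v₀ (1 * s) x‖ ^ 2)
          (closedBall x₀ 2) volume := by
        refine Integrable.bdd_mul hsq hθc.aestronglyMeasurable.restrict (Eventually.of_forall hθbd) |>.congr ?_
        exact Eventually.of_forall fun x => by simp [he, Pi.sub_apply]
      refine (integrableOn_iff_integrable_of_support_subset (s := closedBall x₀ 2) fun x hx => ?_).1 hI
      by_contra hxK
      exact hx (show cutoff (1 : ℝ) (x - x₀) ^ 2 * ‖v s x - heatFlow v₀ (1 * s) x‖ ^ 2 = 0 by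
        rw [hθK x hxK, zero_mul])
    have hlin : ∫⁻ x in ball x₀ 1, ‖(v s - e s) x‖ₑ ^ 2 ≤ ENNReal.ofReal (b s) := by
      calc ∫⁻ x in ball x₀ 1, ‖(v s - e s) x‖ₑ ^ 2
          = ∫⁻ x in ball x₀ 1, ENNReal.ofReal (cutoff (1 : ℝ) (x - x₀) ^ 2 * ‖v s x - heatFlow v₀ (1 * s) x‖ ^ 2) := by
            refine setLIntegral_congr_fun measurableSet_ball (fun x hx => ?_)
            rw [hθ1 x hx, one_mul, ← ofReal_norm, ENNReal.ofReal_pow (norm_nonneg _)]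
            simp [he, Pi.sub_apply]
        _ ≤ ∫⁻ x, ENNReal.ofReal (cutoff (1 : ℝ) (x - x₀) ^ 2 * ‖v s x - heatFlow v₀ (1 * s) x‖ ^ 2) :=
            lintegral_mono' Measure.restrict_le_self le_rfl
        _ = ENNReal.ofReal (∫ x, cutoff (1 : ℝ) (x - x₀) ^ 2 * ‖v s x - heatFlow v₀ (1 * s) x‖ ^ 2) := by
            rw [ofReal_integral_eq_lintegral_ofReal hint (Eventually.of_forall fun x =>
              mul_nonneg (sq_nonneg _) (sq_nonneg _))]
        _ ≤ ENNReal.ofReal (b s) := ENNReal.ofReal_le_ofReal hYs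
    have hnorm : (eLpNorm (v s - e s) 2 μB).toReal ≤ Real.sqrt (b t) := by
      have h1 : eLpNorm (v s - e s) 2 μB ≤ ENNReal.ofReal (b s) ^ (1 / 2 : ℝ) := by
        rw [hμB, eLpNorm_eq_lintegral_rpow_enorm_toReal (by norm_num) (by norm_num)]
        simp only [ENNReal.toReal_ofNat, ENNReal.rpow_ofNat]
        exact ENNReal.rpow_le_rpow hlin (by norm_num)
      have h2 : (ENNReal.ofReal (b s) ^ (1 / 2 : ℝ)).toReal = Real.sqrt (b s) := by
        rw [← ENNReal.toReal_rpow, ENNReal.toReal_ofReal (hb0 s), Real.sqrt_eq_rpow]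
      calc (eLpNorm (v s - e s) 2 μB).toReal ≤ (ENNReal.ofReal (b s) ^ (1 / 2 : ℝ)).toReal :=
            ENNReal.toReal_mono (ENNReal.rpow_ne_top_of_nonneg (by norm_num) ENNReal.ofReal_ne_top) h1
        _ = Real.sqrt (b s) := h2
        _ ≤ Real.sqrt (b t) := Real.sqrt_le_sqrt (hmono hst.le)
    calc |F s| = |∫ x in ball x₀ 1, ⟪(v s - e s) x, g x⟫| := by
          rw [hF]; dsimp only; rw [integral_inner_eq_setIntegral_of_tsupport_subset _ hsupp]
      _ ≤ (eLpNorm (v s - e s) 2 μB).toReal * (eLpNorm g 2 μB).toReal :=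
          FunctionSpaces.abs_integral_inner_le_eLpNorm_two_mul hws hg2
      _ ≤ Bd := mul_le_mul_of_nonneg_right hnorm ENNReal.toReal_nonneg
  -- passage to the limit `s → t⁻`
  have hFt : |F t| ≤ Bd := by
    by_contra H
    have H' : Bd < |F t| := not_le.1 H
    have hc : ContinuousWithinAt (fun s => |F s|) (Iio t) t :=
      continuous_abs.continuousAt.comp_continuousWithinAt hFcont
    have hev : ∀ᶠ s in 𝓝[<] t, Bd < |F s| := hc.eventually (lt_mem_nhds H')
    obtain ⟨s, hst, hs0, hps, hqs⟩ := exists_mem_Ioo_of_ae_of_eventually ht.2.le ht.1 hae hev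
    exact absurd (hgood s hst hs0 hps) (not_le.2 hqs)
  exact hFt

end Main

end BarkerPrange2020

end Literature.Analysis.FluidPDE

end
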